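import Literature.Barriers.QuantumAdvantage.PPolyOraclesPPoly
import Literature.Barriers.QuantumAdvantage.PPolyOraclesLemma82
import Literature.Barriers.QuantumAdvantage.PPolyOraclesSampToLanguage
import Literature.Computability.Cryptography.LubyRackoffIdeal
import Literature.Computability.Cryptography.LubyRackoffIdealProofs
import Literature.Computability.Cryptography.PseudorandomnessPRFProofs
import Literature.Computability.QuantumComplexity.CoinFamilyKernelProofs
import HarnessLib
import Summits.PneNP.PneNP.Theorems.OWFExist

/-!
# Barrier `PPolyOracles` (Aaronson–Chen 2017, Thms. 7.6 and 8.1): the assembly from the current frontier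

Top of the provefact decomposition of
`Literature.Barriers.QuantumAdvantage.PPolyOracles = aaronsonChen2017_thm76 ∧ aaronsonChen2017_thm81`
(`PPolyOracles.lean`; S. Aaronson, L. Chen, *Complexity-theoretic foundations of quantum supremacy
experiments*, CCC 2017, arXiv:1612.05903 [AaronsonChen2017], Thm. 7.6 p. 30, Thm. 8.1 p. 32). This
file adds NO definition and NO named fact: it imports the four sibling proof files in which the
eight leaves of `PPolyOracles_of_leaves` (`PPolyOraclesProofs.lean`) have meanwhile been proved
or reduced, checks that they elaborate together, and PROVES the single assembly
`PPolyOracles_of_frontier` from exactly the named facts that are still undischarged in the tree,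
so that the discharge `PPolyOracles_holds` is the one-liner
`PPolyOracles_of_frontier X₁_holds … X₉_holds` once they land.

**The frontier (nine named facts, by printed step).**

* Lemma 7.4 [hill, ggm, luby1988construct] "if one-way functions exist, then there exist secure
  PRFs and PRPs": `PRGExist_iff_OWFExist` (HILL), `PRFExist_of_PRGExist` (GGM) —
  `Cryptography/Pseudorandomness.lean`; Luby–Rackoff through
  `LubyRackoff.PRPExist_of_PRFExist_of : HybridStep → MainLemma → PRPExist_of_PRFExist`
  (`Cryptography/LubyRackoffIdeal.lean`): `LubyRackoff.HybridStep`, `LubyRackoff.MainLemma`.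
* Thm. 7.6 from a secure PRP (§7.2–7.3), `aaronsonChen2017_thm76_of_prp`, through
  `aaronsonChen2017_thm76_of_prp_of_leaves₃` (`PPolyOraclesPPoly.lean`: the diagonalization of the
  printed proof, the switching half of Lemma 7.5 (1) `aaronsonChen2017_lem75_prp_isPRF_holds` and
  the `P/poly` sentence `aaronsonChen2017_thm76_ppoly_holds` being proved):
  `aaronsonChen2017_lem75_prfMod_isPRF` (`Cryptography/ZhandryPRFMod.lean`, Lemma 7.5 (1) for
  `PRF^mod`), `aaronsonChen2017_lem75_quantum` (`PPolyOraclesThm76.lean`, Lemma 7.5 (2)–(3) and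
  the `BQP^O` machine), `acLang_bppCompiles` (`PPolyOraclesThm76.lean`, "let `M` be a `BPP`
  machine" as a PRF adversary).
* Thm. 8.1: Lemma 8.2 through `aaronsonChen2017_lem82_of_machine` (`PPolyOraclesLemma82.lean`,
  the PAC-learning analysis being proved): `aaronsonChen2017_lem82_machine`; the two
  classical-in-quantum inclusions `SampBPP^A ⊆ SampBQP^A`, `BPP^A ⊆ BQP^A` through
  `SampPRel_subset_SampBQPRel_of_sim`, `BPPRel_ofLanguage_subset_BQPRel_of_sim`:
  `Literature.Computability.QuantumComplexity.uniformOracleCoinSimulation`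
  (`QuantumComplexity/CoinFamilyKernel.lean`); the bridge "consequently `BPP^O = BQP^O`" is
  proved (`BQPRel_subset_BPPRel_of_sampBQPRel_subset_holds`, `PPolyOraclesSampToLanguage.lean`).

**Second pass (three of the nine discharged in the tree).** `PRFExist_of_PRGExist_holds`
(`Cryptography/PseudorandomnessPRFProofs.lean`, GGM through `GGM1986_thm3_holds`),
`LubyRackoff.MainLemma_holds` (`Cryptography/LubyRackoffIdealProofs.lean`, by the coefficient-H
bound of `HCoefficient.lean`) and `uniformOracleCoinSimulation_holds`
(`QuantumComplexity/CoinFamilyKernelProofs.lean`) are now theorems; the section "Six leaves left"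
feeds them in: `PRPExist_of_hybridStep` (Luby–Rackoff from the hybrid step alone),
`aaronsonChen2017_thm81_of_machine` (Thm. 8.1 from the machine half of Lemma 8.2 alone),
`aaronsonChen2017_thm76_of_frontier₅` and `PPolyOracles_of_frontier₆` — the barrier from the SIX
remaining named facts `PRGExist_iff_OWFExist` (HILL), `LubyRackoff.HybridStep`,
`aaronsonChen2017_lem75_prfMod_isPRF`, `aaronsonChen2017_lem75_quantum` (the `Barriers` one),
`acLang_bppCompiles`, `aaronsonChen2017_lem82_machine`.

## Main statements

* `PRPExist_of_frontier`, `aaronsonChen2017_thm76_of_frontier`, `aaronsonChen2017_thm81_of_frontier`: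
  the three printed steps from their frontier facts;
* `PPolyOracles_of_frontier`: the barrier decl from the nine frontier facts.
* `PRPExist_of_hybridStep`, `aaronsonChen2017_thm81_of_machine`,
  `aaronsonChen2017_thm76_of_frontier₅`, `PPolyOracles_of_frontier₆`: the same with GGM, the
  Luby–Rackoff main lemma and the coin simulation fed from their tree discharges (six facts left).

## References

* [AaronsonChen2017] S. Aaronson, L. Chen, CCC 2017, LIPIcs 79, 22:1–22:67,
  doi:10.4230/LIPIcs.CCC.2017.22, arXiv:1612.05903 — Lemma 7.4, Lemma 7.5, Thm. 7.6 (pp. 29–30),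
  Thm. 8.1, Lemma 8.2 (pp. 32–33).
-/

noncomputable section

namespace Literature.Barriers.QuantumAdvantage

open Literature.Computability.Complexity Literature.Computability.Cryptography
  Literature.Computability.QuantumComplexity

/-- **Lemma 7.4, PRP half, from the frontier**: Luby–Rackoff's `PRFExist → PRPExist` from the
hybrid step and the main lemma of `LubyRackoffIdeal.lean`.
[cite: AaronsonChen2017, Lemma 7.4 (p. 29)] [cite: LubyRackoff1988, abstract (main result)] -/
theorem PRPExist_of_frontier (hH : LubyRackoff.HybridStep) (hM : LubyRackoff.MainLemma) :
    PRPExist_of_PRFExist :=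
  LubyRackoff.PRPExist_of_PRFExist_of hH hM

/-- **Thm. 7.6 from the frontier**: one-way functions give an oracle `O ∈ P/poly` with
`BPP^O ≠ BQP^O`, from HILL, GGM, Luby–Rackoff (two facts) and the three remaining leaves of the
proved diagonalization. [cite: AaronsonChen2017, Thm. 7.6 (p. 30), Lemma 7.4, Lemma 7.5] -/
theorem aaronsonChen2017_thm76_of_frontier (hHILL : PRGExist_iff_OWFExist)
    (hGGM : PRFExist_of_PRGExist) (hH : LubyRackoff.HybridStep) (hM : LubyRackoff.MainLemma)
    (h75 : aaronsonChen2017_lem75_prfMod_isPRF)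
    (hq : Literature.Barriers.QuantumAdvantage.aaronsonChen2017_lem75_quantum)
    (hc : acLang_bppCompiles) : aaronsonChen2017_thm76 :=
  aaronsonChen2017_thm76_of_parts' hHILL hGGM (PRPExist_of_frontier hH hM)
    (aaronsonChen2017_thm76_of_prp_of_leaves₃ aaronsonChen2017_lem75_prp_isPRF_holds h75 hq hc)

/-- **Thm. 8.1 from the frontier**: the machine half of Lemma 8.2 and the relativized reversible
coin simulation. [cite: AaronsonChen2017, Thm. 8.1 and Lemma 8.2 (p. 32)] -/
theorem aaronsonChen2017_thm81_of_frontier (h82 : aaronsonChen2017_lem82_machine)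
    (hsim : uniformOracleCoinSimulation) : aaronsonChen2017_thm81 :=
  aaronsonChen2017_thm81_of_lem82_of_sim (aaronsonChen2017_lem82_of_machine h82) hsim

/-- **`PPolyOracles` from the current frontier** (nine named facts): HILL, GGM, Luby–Rackoff's
hybrid step and main lemma, Lemma 7.5 (1) for `PRF^mod`, the quantum machine of Lemma 7.5 (2)–(3),
the `BPP^O`-machine-to-adversary compilation, the machine half of Lemma 8.2, and the relativized
reversible coin simulation. The discharge `PPolyOracles_holds` is this theorem applied to their
`_holds`. [cite: AaronsonChen2017, Thm. 7.6 (p. 30) and Thm. 8.1 (p. 32)] -/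
theorem PPolyOracles_of_frontier (hHILL : PRGExist_iff_OWFExist) (hGGM : PRFExist_of_PRGExist)
    (hH : LubyRackoff.HybridStep) (hM : LubyRackoff.MainLemma)
    (h75 : aaronsonChen2017_lem75_prfMod_isPRF)
    (hq : Literature.Barriers.QuantumAdvantage.aaronsonChen2017_lem75_quantum)
    (hc : acLang_bppCompiles) (h82 : aaronsonChen2017_lem82_machine)
    (hsim : uniformOracleCoinSimulation) : PPolyOracles :=
  ⟨aaronsonChen2017_thm76_of_frontier hHILL hGGM hH hM h75 hq hc,
    aaronsonChen2017_thm81_of_frontier h82 hsim⟩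

/-! ### Six leaves left: GGM, the Luby–Rackoff main lemma and the coin simulation fed in -/

/-- **Lemma 7.4, PRP half, from the hybrid step alone**: Luby–Rackoff's `PRFExist → PRPExist`,
the main lemma being the tree theorem `LubyRackoff.MainLemma_holds`.
[cite: AaronsonChen2017, Lemma 7.4 (p. 29)] [cite: Goldreich2001, Thm. 3.7.7 and Prop. 3.7.8 (pp. 203–205)] -/
theorem PRPExist_of_hybridStep (hH : LubyRackoff.HybridStep) : PRPExist_of_PRFExist :=
  PRPExist_of_frontier hH LubyRackoff.MainLemma_holds

/-- **Lemma 7.4 from HILL and the hybrid step** ("if one-way functions exist, then there exist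
secure PRFs and PRPs", stated here as the printed implication `OWFExist → PRFExist ∧ PRPExist`
over the tree's classes), GGM being the tree theorem `PRFExist_of_PRGExist_holds` and the
Luby–Rackoff main lemma the tree theorem `LubyRackoff.MainLemma_holds`: the two hypotheses are
exactly the named facts of `Cryptography/` on which Lemma 7.4 still rests (D-0026 review of the
decomposition: Lemma 7.4 is a citation lemma, "[HILL99, GGM86, GL89, LR88]", with no proof
obligation of its own beyond these pre-existing facts). [cite: AaronsonChen2017, Lemma 7.4 (p. 29)] -/
theorem aaronsonChen2017_lem74_of_frontier₂ (hHILL : PRGExist_iff_OWFExist)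
    (hH : LubyRackoff.HybridStep) : Summit.PneNP.PneNP.OWFExist → PRFExist ∧ PRPExist :=
  aaronsonChen2017_lem74_of_parts hHILL PRFExist_of_PRGExist_holds (PRPExist_of_hybridStep hH)

/-- **Thm. 7.6 from five leaves**: HILL, the Luby–Rackoff hybrid step, Lemma 7.5 (1) for
`PRF^mod`, the quantum machine of Lemma 7.5 (2)–(3) and the `BPP^O`-machine compilation.
[cite: AaronsonChen2017, Thm. 7.6 (p. 30), Lemma 7.4, Lemma 7.5] -/
theorem aaronsonChen2017_thm76_of_frontier₅ (hHILL : PRGExist_iff_OWFExist)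
    (hH : LubyRackoff.HybridStep) (h75 : aaronsonChen2017_lem75_prfMod_isPRF)
    (hq : Literature.Barriers.QuantumAdvantage.aaronsonChen2017_lem75_quantum)
    (hc : acLang_bppCompiles) : aaronsonChen2017_thm76 :=
  aaronsonChen2017_thm76_of_frontier hHILL PRFExist_of_PRGExist_holds hH LubyRackoff.MainLemma_holds
    h75 hq hc

/-- **Thm. 8.1 from the machine half of Lemma 8.2 alone**, the relativized reversible coin
simulation being the tree theorem `uniformOracleCoinSimulation_holds` (whence both
classical-in-quantum inclusions). [cite: AaronsonChen2017, Thm. 8.1 and Lemma 8.2 (p. 32)] -/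
theorem aaronsonChen2017_thm81_of_machine (h82 : aaronsonChen2017_lem82_machine) :
    aaronsonChen2017_thm81 :=
  aaronsonChen2017_thm81_of_frontier h82 uniformOracleCoinSimulation_holds

/-- **`PPolyOracles` from the six remaining named facts**: HILL (`PRGExist_iff_OWFExist`), the
Luby–Rackoff hybrid step, Lemma 7.5 (1) for `PRF^mod`, the quantum machine of Lemma 7.5 (2)–(3),
the `BPP^O`-machine compilation and the machine half of Lemma 8.2. The discharge
`PPolyOracles_holds` is this theorem applied to their `_holds`.
[cite: AaronsonChen2017, Thm. 7.6 (p. 30) and Thm. 8.1 (p. 32)] -/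
theorem PPolyOracles_of_frontier₆ (hHILL : PRGExist_iff_OWFExist) (hH : LubyRackoff.HybridStep)
    (h75 : aaronsonChen2017_lem75_prfMod_isPRF)
    (hq : Literature.Barriers.QuantumAdvantage.aaronsonChen2017_lem75_quantum)
    (hc : acLang_bppCompiles) (h82 : aaronsonChen2017_lem82_machine) : PPolyOracles :=
  ⟨aaronsonChen2017_thm76_of_frontier₅ hHILL hH h75 hq hc, aaronsonChen2017_thm81_of_machine h82⟩

end Literature.Barriers.QuantumAdvantage

end
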